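import Literature.AlgebraicGeometry.Resolution.WeightedCentreAdditiveShifts
import Literature.AlgebraicGeometry.Resolution.WeightedCentrePolyShift
import Mathlib.Algebra.Polynomial.Expand
import HarnessLib

/-!
# LEMMA L, first step: a `σ^r`-monomial fixing shift IS a line of translations fixing `G`
# (instrument for engine 1's `W(f)` toy model, NOT a resolution theorem)

Engine 1 of the RESOLUTION OBSERVATORY toy model `W(f)` (RE-DERIVATION-eng1-g41 §3.7.2–3.7.4: LEMMA G / LEMMA C / LEMMA L /
THEOREM RZ; CARVER-NOTES-eng1-g42 T92) runs the "group trick": the additive fixing shifts `P = (P_x)_x` off `U`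
(`AdditiveShift.fixingShifts U G` of `WeightedCentreAdditiveShifts`: `G((ε_x + P_x(σ, ε_U))_x) = G(ε)`) form a group stable under
`σ ↦ μσ`; the characters of `𝔽_p^×` project a fixing shift onto its `σ^r`-part `σ^r · P_r(ε_U)` (`2 ≤ r ≤ p − 1`, LEMMA C); and
LEMMA L starts from such a MONOMIAL-IN-`σ` fixing shift: "the identity `G(ε + t σ^r P_r) = G` holds for all `t`; put `σ = 1`".

This file is the bridge from the group to the line, WITHOUT any base change to `k̄` or to `k[λ]`: `σ` itself is the free
parameter.  For a `σ`-free direction field `v : ι → k[ε]`,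
* `AdditiveShift.shiftHom_C_mul_X_pow_C` — the shift by `x ↦ v_x · σ^r` acts on `G` as `G(ε + t·v)|_{t := σ^r}`:
  `Φ_{v σ^r}(G) = expand_r (polyShift v G)` (`PolyShift.polyShift` of `WeightedCentrePolyShift`, Mathlib's `Polynomial.expand`);
* `AdditiveShift.isIsotropyOf_iff_polyShift_eq_C` — hence, for `r ≥ 1`, `Φ_{v σ^r}` fixes `G` iff `G(ε + t·v) = G(ε)`
  identically in `t` (`Polynomial.expand` is injective): the isotropy IS the line `t ↦ ε + t v` of translations fixing `G`;
  membership form `mem_fixingShifts_C_mul_X_pow_iff`;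
* `AdditiveShift.isInvariantDir_of_isIsotropyOf_const` / `…_C_mul` — the two shapes LEMMA L and REMARK L′ consume: a CONSTANT
  field `v = c` gives the invariant direction `c` of `G` (`InvariantDirection.IsInvariantDir`), and over a domain so does
  `v = c · Q` with `Q ≠ 0` (`PolyShift.isInvariantDir_of_polyShift_C_mul`); conversely an invariant direction `c` puts the whole
  family `(c·Q) σ^r` into the stabiliser (`isIsotropyOf_of_isInvariantDir`) — the lines INSIDE the group.
The graded reduction to the lightest moved class and its lex-leading vertex (`WeightedCentreVertexStep`) and the pin
contradiction (`WeightedCentreClassLinearPin`) are assembled elsewhere; the character projection is `WeightedCentreCharacterSum`.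

References: substitution / Taylor expansion along a line and algebraic independence [Lang2002, Ch. IV §1]; the stabiliser
bookkeeping [SerreLocalFields1979, Ch. II §4 Lemma 1]; the weighted frame [AbramovichTemkinWlodarczyk2024, Thm. 5.3.1].
All statements are OURS (toy-model bookkeeping) — instruments for engine 1's `W(f)` model, NOT resolution theorems.
-/

namespace Literature.AlgebraicGeometry.Resolution.WeightedBlowup

open Polynomial

namespace AdditiveShift

variable {k : Type*} [CommRing k] {ι : Type*}

/-- A `σ`-monomial whose coefficient lies in `k[ε_U]` is over `U` (ours, bookkeeping). [cite: SerreLocalFields1979, Ch. II §4 Lemma 1] -/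
theorem IsOver.C_mul_X_pow {U : Set ι} {q : MvPolynomial ι k} (hq : ∀ j ∈ q.vars, j ∈ U) (r : ℕ) :
    IsOver U (C q * Polynomial.X ^ r) := fun s j hj => by
  rw [Polynomial.coeff_C_mul_X_pow] at hj
  split_ifs at hj with h
  · exact hq j hj
  · simp only [MvPolynomial.vars_0, Finset.notMem_empty] at hj

/-- **The shift by `v·σ^r` is the line along `v` read at `t := σ^r`** (ours): `Φ_{(v_x σ^r)_x}(G) = expand_r (G(ε + t·v))`.
[cite: Lang2002, Ch. IV §1] -/
theorem shiftHom_C_mul_X_pow_C (v : ι → MvPolynomial ι k) (r : ℕ) (G : MvPolynomial ι k) :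
    shiftHom (fun x => C (v x) * X ^ r) (C G) = Polynomial.expand (MvPolynomial ι k) r (PolyShift.polyShift v G) := by
  have key : (shiftHom (fun x => C (v x) * X ^ r)).comp C =
      (Polynomial.expand (MvPolynomial ι k) r).toRingHom.comp (PolyShift.polyShift v).toRingHom := by
    refine MvPolynomial.ringHom_ext (fun c => ?_) (fun j => ?_)
    · simp only [RingHom.comp_apply, shiftHom_C_C, AlgHom.toRingHom_eq_coe, RingHom.coe_coe, PolyShift.polyShift_C,
        Polynomial.expand_C]
    · simp only [RingHom.comp_apply, shiftHom_C_X, AlgHom.toRingHom_eq_coe, RingHom.coe_coe, PolyShift.polyShift_X, map_add,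
        map_mul, Polynomial.expand_C, Polynomial.expand_X, mul_comm]
  exact RingHom.congr_fun key G

/-- If the line of translations along `v` fixes `G`, every shift `Φ_{v σ^r}` fixes `G` (ours). [cite: Lang2002, Ch. IV §1] -/
theorem isIsotropyOf_of_polyShift_eq_C {v : ι → MvPolynomial ι k} {G : MvPolynomial ι k}
    (h : PolyShift.polyShift v G = C G) (r : ℕ) : IsIsotropyOf G (shiftHom fun x => C (v x) * X ^ r) := by
  change shiftHom _ (C G) = C G
  rw [shiftHom_C_mul_X_pow_C, h, Polynomial.expand_C]

/-- **The isotropy IS the line** (ours): for `r ≥ 1`, `Φ_{v σ^r}` fixes `G` iff `G(ε + t·v) = G(ε)` identically in `t` — `σ` is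
the free parameter, no base change needed (`Polynomial.expand` is injective). [cite: Lang2002, Ch. IV §1] -/
theorem isIsotropyOf_iff_polyShift_eq_C {v : ι → MvPolynomial ι k} {r : ℕ} (hr : 0 < r) {G : MvPolynomial ι k} :
    IsIsotropyOf G (shiftHom fun x => C (v x) * X ^ r) ↔ PolyShift.polyShift v G = C G := by
  refine ⟨fun h => Polynomial.expand_injective hr ?_, fun h => isIsotropyOf_of_polyShift_eq_C h r⟩
  rw [Polynomial.expand_C, ← shiftHom_C_mul_X_pow_C]
  exact h

/-- Membership form (ours): for a `σ`-free field `v` over `U` vanishing on `U` and `r ≥ 1`,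
`(v_x σ^r)_x ∈ fixingShifts U G ↔ G(ε + t·v) = G(ε)`. [cite: SerreLocalFields1979, Ch. II §4 Lemma 1; Lang2002, Ch. IV §1] -/
theorem mem_fixingShifts_C_mul_X_pow_iff [DecidableEq ι] {U : Set ι} {v : ι → MvPolynomial ι k} (hv0 : ∀ u ∈ U, v u = 0)
    (hvU : ∀ x, ∀ j ∈ (v x).vars, j ∈ U) {r : ℕ} (hr : 0 < r) {G : MvPolynomial ι k} :
    (fun x => C (v x) * X ^ r) ∈ fixingShifts U G ↔ PolyShift.polyShift v G = C G := by
  rw [mem_fixingShifts_iff, isIsotropyOf_iff_polyShift_eq_C hr]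
  exact ⟨fun h => h.2.2,
    fun h => ⟨fun u hu => by rw [hv0 u hu, map_zero, zero_mul], fun x => IsOver.C_mul_X_pow (hvU x) r, h⟩⟩

/-- **LEMMA L, constant field** (ours): if `Φ_{c σ^r}` (`c ∈ k^ι` constant, `r ≥ 1`) fixes `G`, then `c` is an invariant direction
of `G`: `G(ε + t c) = G(ε)`. [cite: Lang2002, Ch. IV §1] -/
theorem isInvariantDir_of_isIsotropyOf_const {c : ι → k} {r : ℕ} (hr : 0 < r) {G : MvPolynomial ι k}
    (h : IsIsotropyOf G (shiftHom fun x => C (MvPolynomial.C (c x)) * X ^ r)) : InvariantDirection.IsInvariantDir G c := by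
  have h' := (isIsotropyOf_iff_polyShift_eq_C (v := fun x => MvPolynomial.C (c x)) hr).mp h
  rwa [PolyShift.polyShift_const] at h'

/-- **REMARK L′ shape** (ours): over a domain, if `Φ_{(c·Q) σ^r}` fixes `G` with `c` constant, `Q ≠ 0`, `r ≥ 1`, then `c` is an
invariant direction of `G`. [cite: Lang2002, Ch. IV §1] -/
theorem isInvariantDir_of_isIsotropyOf_C_mul [NoZeroDivisors k] (c : ι → k) {Q : MvPolynomial ι k} (hQ : Q ≠ 0) {r : ℕ}
    (hr : 0 < r) {G : MvPolynomial ι k} (h : IsIsotropyOf G (shiftHom fun x => C (MvPolynomial.C (c x) * Q) * X ^ r)) :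
    InvariantDirection.IsInvariantDir G c :=
  PolyShift.isInvariantDir_of_polyShift_C_mul c hQ ((isIsotropyOf_iff_polyShift_eq_C hr).mp h)

/-- **Lines inside the stabiliser** (ours): an invariant direction `c` of `G` puts every shift `Φ_{(c·Q) σ^r}` into the isotropies
of `G` — the converse of the two statements above. [cite: Lang2002, Ch. IV §1] -/
theorem isIsotropyOf_of_isInvariantDir {G : MvPolynomial ι k} {c : ι → k} (hc : InvariantDirection.IsInvariantDir G c)
    (Q : MvPolynomial ι k) (r : ℕ) : IsIsotropyOf G (shiftHom fun x => C (MvPolynomial.C (c x) * Q) * X ^ r) :=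
  isIsotropyOf_of_polyShift_eq_C (PolyShift.polyShift_eq_C_of_isInvariantDir hc Q) r

/-! ## A worked instance -/

/-- Smoke test (ours): `G = ε₀` on two slots has the invariant direction `e₁`, so the shift `ε₁ ↦ ε₁ + ε₀·σ²` fixes `G`, and —
reading the isotropy back as a line — `e₁` is recovered as an invariant direction. [cite: Lang2002, Ch. IV §1] -/
example : InvariantDirection.IsInvariantDir (MvPolynomial.X 0 : MvPolynomial (Fin 2) ℚ) (Pi.single 1 1) := by
  have hc : InvariantDirection.IsInvariantDir (MvPolynomial.X 0 : MvPolynomial (Fin 2) ℚ) (Pi.single 1 1) := by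
    change InvariantDirection.lineShift _ _ = _
    rw [InvariantDirection.lineShift_X]
    simp
  have hiso := isIsotropyOf_of_isInvariantDir hc (MvPolynomial.X 0) 2
  exact isInvariantDir_of_isIsotropyOf_C_mul (Pi.single 1 1) (MvPolynomial.X_ne_zero 0) two_pos hiso

end AdditiveShift

end Literature.AlgebraicGeometry.Resolution.WeightedBlowup
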